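import Mathlib
import Literature.Analysis.FluidPDE.BoundedL2ClassicalMild
import Literature.Analysis.FluidPDE.KNSSTypeIRateMildBridge
import Literature.Analysis.FluidPDE.KNSSMildDecayHorizontal
import Literature.Analysis.FluidPDE.ClassicalSolutionCalculus

/-!
# Crux `SlicedKelvin.PlanarFluxAPriori` (stmt-NavierStokesRegularity-15600), line `registered`,
# stub `stub_decayPersistence` — the Oseen representation from the initial time

Support file (theorems only) for the decay-persistence stub. A classical solution `(u, p)` of
the unforced Navier–Stokes system with viscosity `ν > 0` on `ℝ³ × [0, T)`, bounded by `L` and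
with square-integrable slices `‖u(τ)‖_{L²} ≤ K < ∞` on `[0, T₁]`, `T₁ < T`, satisfies the Oseen
(mild) integral equation **from the initial time**:

  `u(τ, x) = e^{ντΔ} u(0) (x) - B^ν_0(u, u)(τ)(x)`,   `0 < τ < T₁`, `x ∈ ℝ³`

(`decay_oseen_representation_from_zero`). Between positive times this is the tree's
`mild_of_bounded_of_eLpNorm_two_le_of_lt` (KNSS 2009 Lemma 3.1 with the parasitic drift killed
by finite energy), transported to viscosity `ν` by the normalisation `ν⁻¹u(s/ν, x)`
(`oseen_of_oseen_timeRescale`); the initial time is reached by letting `s → 0⁺`, the caloric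
term being continuous in the datum (dominated convergence under a fixed Gaussian, the tree's
`continuousAt_heatExtension_datum` applied to the extension `r ↦ u(max(r/ν, 0))`) and the Duhamel
term being a primitive of an integrable marginal.

## References

* G. Koch, N. Nadirashvili, G. Seregin, V. Šverák, Acta Math. 203 (2009), §3 Lemma 3.1, §4.
* P. G. Lemarié-Rieusset, *The Navier–Stokes Problem in the 21st Century* (2016), Thm. 6.1.
-/

noncomputable section

-- the summit and its single sub-problem share the name (CONVENTIONS §1), as in every Theorems file
set_option linter.dupNamespace false

namespace Summit.NavierStokesRegularity.NavierStokesRegularity.Theorems.SlicedKelvinPlanarFluxAPriori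

open MeasureTheory Set Filter Topology Metric Real Function
open scoped ENNReal NNReal
open Literature.Analysis.FluidPDE Literature.Analysis.UnboundedOperators

/-- **The Oseen equation between positive times, viscosity `ν`.** A classical solution on
`ℝ³ × [0, T)` (`ν > 0`), bounded by `L` and with `‖u(τ)‖_{L²} ≤ K < ∞` on `[0, T₁]`, `T₁ < T`,
satisfies `u(t) = e^{ν(t-s)Δ}u(s) - B^ν_s(u,u)(t)` pointwise for all `0 < s < t < T₁`
(`mild_of_bounded_of_eLpNorm_two_le_of_lt` for the normalised field `ν⁻¹u(r/ν, x)` on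
`(0, νT)`, and `oseen_of_oseen_timeRescale`). -/
theorem decay_oseen_representation_of_pos {ν T : ℝ} (hν : 0 < ν)
    {u : ℝ → EuclideanSpace ℝ (Fin 3) → EuclideanSpace ℝ (Fin 3)}
    {p : ℝ → EuclideanSpace ℝ (Fin 3) → ℝ} (hcl : IsClassicalNSSolutionOn (Ico 0 T) ν 0 u p)
    {T₁ : ℝ} (hT₁ : T₁ < T) {L : ℝ} (hL : ∀ τ ∈ Icc 0 T₁, ∀ x, ‖u τ x‖ ≤ L) {K : ℝ≥0∞}
    (hK : K ≠ ∞) (hK2 : ∀ τ ∈ Icc 0 T₁, eLpNorm (u τ) 2 volume ≤ K) {s t : ℝ} (hs : 0 < s)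
    (hst : s < t) (ht : t < T₁) (x : EuclideanSpace ℝ (Fin 3)) :
    u t x = heatExtension (u s) (ν * (t - s)) x - oseenDuhamel ν s u u t x := by
  -- the classical solution on the open interval
  have hcl' : IsClassicalNSSolutionOn (Ioo 0 T) ν 0 u p := hcl.mono Ioo_subset_Ico_self (uniqueDiffOn_Ioo 0 T)
  -- the normalised field with unit viscosity on `(0, νT)`
  have hmaps : MapsTo (fun r => ν⁻¹ * r) (Ioo 0 (ν * T)) (Ioo 0 T) :=
    fun r hr => (inv_mul_mem_Ioo_iff hν).2 hr
  have h1 : IsClassicalNSSolutionOn (Ioo 0 (ν * T)) 1 0 (timeRescale ν⁻¹ ν⁻¹ u)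
      (timeRescale ν⁻¹ (ν⁻¹ ^ 2) p) := by
    simpa using hcl'.viscosityRescale_set hν.ne' hmaps isOpen_Ioo.uniqueDiffOn
  have hinv : 0 ≤ ν⁻¹ := inv_nonneg.2 hν.le
  have hT₁0 : 0 < T₁ := hs.trans (hst.trans ht)
  -- bounds on `(0, νT₁] × ℝ³`
  have hmem : ∀ r ∈ Ioc 0 (ν * T₁), ν⁻¹ * r ∈ Icc 0 T₁ := by
    intro r hr
    refine ⟨mul_nonneg hinv hr.1.le, ?_⟩
    calc ν⁻¹ * r ≤ ν⁻¹ * (ν * T₁) := mul_le_mul_of_nonneg_left hr.2 hinv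
      _ = T₁ := by field_simp
  have hLr : ∀ r ∈ Ioc 0 (ν * T₁), ∀ y, ‖timeRescale ν⁻¹ ν⁻¹ u r y‖ ≤ ν⁻¹ * L := by
    intro r hr y
    rw [timeRescale_apply, norm_smul, Real.norm_of_nonneg hinv]
    exact mul_le_mul_of_nonneg_left (hL _ (hmem r hr) y) hinv
  have hKr : ∀ r ∈ Ioc 0 (ν * T₁), eLpNorm (timeRescale ν⁻¹ ν⁻¹ u r) 2 volume ≤ ‖ν⁻¹‖ₑ * K := by
    intro r hr
    rw [timeRescale_slice, show (fun y => ν⁻¹ • u (ν⁻¹ * r) y) = ν⁻¹ • u (ν⁻¹ * r) from rfl,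
      eLpNorm_const_smul]
    exact mul_le_mul_right (hK2 _ (hmem r hr)) _
  have hKtop : ‖ν⁻¹‖ₑ * K ≠ ∞ := ENNReal.mul_ne_top enorm_ne_top hK
  -- the mildness theorem for the normalised field between `νs < νt < νT₁`
  have key := mild_of_bounded_of_eLpNorm_two_le_of_lt h1 (mul_pos hν hT₁0)
    (mul_lt_mul_of_pos_left hT₁ hν) hLr hKtop hKr (s := ν * s) (t := ν * t) (mul_pos hν hs)
    (mul_lt_mul_of_pos_left hst hν) (mul_lt_mul_of_pos_left ht hν) x
  exact oseen_of_oseen_timeRescale hν hst.le key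

/-- **Continuity of the caloric term in the datum at the initial time** (one-sided). For `u`
continuous on `[0, T) × ℝ³` and bounded on `[0, T₁]`, `ν > 0`, `0 < τ ≤ T₁ < T`:
`e^{ν(τ-s)Δ} u(s) (x) → e^{ντΔ} u(0) (x)` as `s → 0⁺` (the tree's
`continuousAt_heatExtension_datum` for the extension `r ↦ u(max(r/ν, 0))` on `(-1, νT₁)`). -/
theorem decay_tendsto_heatExtension_datum_zero {ν T : ℝ} (hν : 0 < ν)
    {u : ℝ → EuclideanSpace ℝ (Fin 3) → EuclideanSpace ℝ (Fin 3)}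
    (hu : ContinuousOn (uncurry u) (Ico 0 T ×ˢ univ)) {T₁ : ℝ} (hT₁ : T₁ < T) {L : ℝ}
    (hL : ∀ τ ∈ Icc 0 T₁, ∀ x, ‖u τ x‖ ≤ L) {τ : ℝ} (hτ : 0 < τ) (hτT : τ ≤ T₁)
    (x : EuclideanSpace ℝ (Fin 3)) :
    Tendsto (fun s => heatExtension (u s) (ν * (τ - s)) x) (𝓝[>] 0)
      (𝓝 (heatExtension (u 0) (ν * τ) x)) := by
  have hT₁0 : 0 < T₁ := hτ.trans_le hτT
  -- the extension `v r = u (max (ν⁻¹ r) 0)` on `(-1, νT₁)`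
  set v : ℝ → EuclideanSpace ℝ (Fin 3) → EuclideanSpace ℝ (Fin 3) := fun r y => u (max (ν⁻¹ * r) 0) y
    with hv
  have hclamp : ∀ r ∈ Ioo (-1) (ν * T₁), max (ν⁻¹ * r) 0 ∈ Icc 0 T₁ := by
    intro r hr
    refine ⟨le_max_right _ _, max_le ?_ hT₁0.le⟩
    calc ν⁻¹ * r ≤ ν⁻¹ * (ν * T₁) := mul_le_mul_of_nonneg_left hr.2.le (inv_nonneg.2 hν.le)
      _ = T₁ := by field_simp
  have hvc : ContinuousOn (uncurry v) (Ioo (-1) (ν * T₁) ×ˢ univ) := by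
    have hmap : ContinuousOn (fun q : ℝ × EuclideanSpace ℝ (Fin 3) => (max (ν⁻¹ * q.1) 0, q.2))
        (Ioo (-1) (ν * T₁) ×ˢ univ) := by fun_prop
    have hmaps : MapsTo (fun q : ℝ × EuclideanSpace ℝ (Fin 3) => (max (ν⁻¹ * q.1) 0, q.2))
        (Ioo (-1) (ν * T₁) ×ˢ univ) (Ico 0 T ×ˢ univ) := by
      intro q hq
      refine ⟨⟨(hclamp q.1 hq.1).1, (hclamp q.1 hq.1).2.trans_lt hT₁⟩, mem_univ _⟩
    have hcomp := hu.comp hmap hmaps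
    exact hcomp
  have hvb : ∀ r ∈ Ioo (-1) (ν * T₁), ∀ y, ‖v r y‖ ≤ L := fun r hr y => hL _ (hclamp r hr) y
  -- continuity at `r₀ = 0` of `r ↦ e^{(ντ - r)Δ} v(r) (x)`
  have hcont := continuousAt_heatExtension_datum hvc hvb (t := ν * τ) (r₀ := 0) (by norm_num)
    (mul_pos hν hT₁0) (mul_pos hν hτ) x
  -- compose with `s ↦ ν s`
  have hcomp : Tendsto (fun s : ℝ => heatExtension (v (ν * s)) (ν * τ - ν * s) x) (𝓝 0)
      (𝓝 (heatExtension (v 0) (ν * τ - 0) x)) := by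
    have hlin : Tendsto (fun s : ℝ => ν * s) (𝓝 0) (𝓝 0) :=
      (continuous_const_mul ν).tendsto' 0 0 (mul_zero ν)
    exact hcont.tendsto.comp hlin
  have hv0 : v 0 = u 0 := by
    funext y; rw [hv]; simp
  rw [hv0, sub_zero] at hcomp
  refine (hcomp.mono_left nhdsWithin_le_nhds).congr' ?_
  filter_upwards [self_mem_nhdsWithin] with s hs
  have hs0 : 0 < s := hs
  have hvs : v (ν * s) = u s := by
    funext y
    rw [hv]; dsimp only
    rw [show ν⁻¹ * (ν * s) = s by field_simp, max_eq_left hs0.le]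
  rw [hvs, mul_sub]

/-- **Continuity of the Duhamel term in the initial time at `0`** (one-sided): for `u`
continuous on `[0, T) × ℝ³` and bounded on `[0, T₁]`, `0 < τ ≤ T₁ < T`,
`B^ν_s(u,u)(τ)(x) → B^ν_0(u,u)(τ)(x)` as `s → 0⁺` (it is `∫_s^τ f` for the marginal
`f(σ) = ∫ K(ν(τ-σ), x-y)[u,u] dy`, integrable on `(0, τ)`). -/
theorem decay_tendsto_oseenDuhamel_initialTime_zero {ν T : ℝ} (hν : 0 < ν)
    {u : ℝ → EuclideanSpace ℝ (Fin 3) → EuclideanSpace ℝ (Fin 3)}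
    (hu : ContinuousOn (uncurry u) (Ico 0 T ×ˢ univ)) {T₁ : ℝ} (hT₁ : T₁ < T) {L : ℝ}
    (hL : ∀ τ ∈ Icc 0 T₁, ∀ x, ‖u τ x‖ ≤ L) {τ : ℝ} (hτ : 0 < τ) (hτT : τ ≤ T₁)
    (x : EuclideanSpace ℝ (Fin 3)) :
    Tendsto (fun s => oseenDuhamel ν s u u τ x) (𝓝[>] 0) (𝓝 (oseenDuhamel ν 0 u u τ x)) := by
  have hL0 : 0 ≤ L := (norm_nonneg _).trans (hL 0 ⟨le_rfl, (hτ.trans_le hτT).le⟩ 0)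
  set f : ℝ → EuclideanSpace ℝ (Fin 3) := fun σ =>
    ∫ y, oseenKernel (ν * (τ - σ)) (x - y) (u σ y) (u σ y) with hf
  -- integrability of the marginal on `(0, τ)`
  have hum : AEStronglyMeasurable (uncurry u)
      ((volume : Measure (ℝ × EuclideanSpace ℝ (Fin 3))).restrict (Ioo 0 τ ×ˢ univ)) :=
    (hu.mono (prod_mono (fun σ hσ => ⟨hσ.1.le, (hσ.2.trans_le hτT).trans hT₁⟩) subset_rfl)).aestronglyMeasurable
      (measurableSet_Ioo.prod MeasurableSet.univ)
  have hbd' : ∀ σ ∈ Ioo 0 τ, ∀ y, ‖u σ y‖ ≤ L := fun σ hσ y =>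
    hL σ ⟨hσ.1.le, hσ.2.le.trans hτT⟩ y
  have hint := integrable_oseenKernel_duhamel_bounded hν hum hum hL0 hbd' hbd' hτ le_rfl x
  rw [volume_restrict_prod_univ_eq_prod] at hint
  have hfi : IntegrableOn f (Ioo 0 τ) := hint.integral_prod_left
  have hfii : IntervalIntegrable f volume 0 τ := by
    rw [intervalIntegrable_iff_integrableOn_Ioo_of_le hτ.le]
    exact hfi
  -- the Duhamel term as a primitive
  have heq : ∀ r ∈ Icc 0 τ, oseenDuhamel ν r u u τ x = -∫ σ in τ..r, f σ := by
    intro r hr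
    rw [oseenDuhamel_apply, intervalIntegral.integral_symm, neg_neg,
      intervalIntegral.integral_of_le hr.2, integral_Ioc_eq_integral_Ioo]
  have hprim : ContinuousOn (fun r => ∫ σ in τ..r, f σ) (uIcc 0 τ) :=
    intervalIntegral.continuousOn_primitive_interval' hfii right_mem_uIcc
  have hcw : ContinuousWithinAt (fun r => -∫ σ in τ..r, f σ) (Icc 0 τ) 0 := by
    have h := (hprim.continuousWithinAt (left_mem_uIcc : (0 : ℝ) ∈ uIcc 0 τ)).neg
    rwa [uIcc_of_le hτ.le] at h
  have hcw' : ContinuousWithinAt (fun r => -∫ σ in τ..r, f σ) (Ioi 0) 0 :=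
    hcw.mono_of_mem_nhdsWithin (Icc_mem_nhdsGT hτ)
  have h0 : oseenDuhamel ν 0 u u τ x = -∫ σ in τ..(0 : ℝ), f σ := heq 0 ⟨le_rfl, hτ.le⟩
  rw [h0]
  refine (hcw'.tendsto).congr' ?_
  filter_upwards [Ioo_mem_nhdsGT hτ] with r hr
  exact (heq r ⟨hr.1.le, hr.2.le⟩).symm

/-- **The Oseen representation from the initial time.** A classical solution `(u, p)` of the
unforced Navier–Stokes system (`ν > 0`) on `ℝ³ × [0, T)`, bounded by `L` and with
`‖u(τ)‖_{L²} ≤ K < ∞` on `[0, T₁]`, `T₁ < T`, satisfies for all `0 < τ < T₁` and `x ∈ ℝ³`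
`u(τ, x) = e^{ντΔ} u(0) (x) - B^ν_0(u, u)(τ)(x)` (KNSS 2009, §4: bounded finite-energy classical
solutions are mild; the initial time by `s → 0⁺`). -/
theorem decay_oseen_representation_from_zero :
    ∀ {ν T : ℝ} (hν : 0 < ν) {u : ℝ → EuclideanSpace ℝ (Fin 3) → EuclideanSpace ℝ (Fin 3)}
    {p : ℝ → EuclideanSpace ℝ (Fin 3) → ℝ}
    (hcl : Literature.Analysis.FluidPDE.IsClassicalNSSolutionOn (Set.Ico 0 T) ν 0 u p)
    {T₁ : ℝ} (hT₁ : T₁ < T) {L : ℝ} (hL : ∀ τ ∈ Set.Icc 0 T₁, ∀ x, ‖u τ x‖ ≤ L) {K : ENNReal}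
    (hK : K ≠ ⊤) (hK2 : ∀ τ ∈ Set.Icc 0 T₁, MeasureTheory.eLpNorm (u τ) 2 MeasureTheory.volume ≤ K)
    {τ : ℝ} (hτ : τ ∈ Set.Ioo 0 T₁) (x : EuclideanSpace ℝ (Fin 3)),
    u τ x = Literature.Analysis.UnboundedOperators.heatExtension (u 0) (ν * τ) x -
      Literature.Analysis.FluidPDE.oseenDuhamel ν 0 u u τ x := by
  intro ν T hν u p hcl T₁ hT₁ L hL K hK hK2 τ hτ x
  have hu : ContinuousOn (uncurry u) (Ico 0 T ×ˢ univ) := hcl.smooth_velocity.continuousOn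
  -- the two limits as `s → 0⁺`
  have h1 := decay_tendsto_heatExtension_datum_zero hν hu hT₁ hL hτ.1 hτ.2.le x
  have h2 := decay_tendsto_oseenDuhamel_initialTime_zero hν hu hT₁ hL hτ.1 hτ.2.le x
  have hlim : Tendsto (fun s => heatExtension (u s) (ν * (τ - s)) x - oseenDuhamel ν s u u τ x)
      (𝓝[>] 0) (𝓝 (heatExtension (u 0) (ν * τ) x - oseenDuhamel ν 0 u u τ x)) := h1.sub h2
  -- the function is constant, equal to `u τ x`, on `(0, τ)`
  have hconst : Tendsto (fun s => heatExtension (u s) (ν * (τ - s)) x - oseenDuhamel ν s u u τ x)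
      (𝓝[>] 0) (𝓝 (u τ x)) := by
    refine tendsto_const_nhds.congr' ?_
    filter_upwards [Ioo_mem_nhdsGT hτ.1] with s hs
    exact decay_oseen_representation_of_pos hν hcl hT₁ hL hK hK2 hs.1 hs.2 hτ.2 x
  exact tendsto_nhds_unique hconst hlim

end Summit.NavierStokesRegularity.NavierStokesRegularity.Theorems.SlicedKelvinPlanarFluxAPriori

end
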